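import Summits.BirchSwinnertonDyer.BirchSwinnertonDyer.Theses.TameQuarticSolvent
import Summits.BirchSwinnertonDyer.BirchSwinnertonDyer.Theses.TameQuarticManinParity
import HarnessLib

/-!
# Route `TameQuarticManinParity`, crux 5 `TprimeRankOneLowerAtThree` (stmt-BirchSwinnertonDyer-23739) —
# BY NAME from route `TameQuarticSolvent`'s deciding crux `SolventPairLowerBound` (21391) and its rank-zero
# upper half (21393): the converse of lead tqs-p1 g4's p588900; the two deciding cruxes are ONE wall

HONEST FRAMING. Theorems only; helper (`--supports stmt-BirchSwinnertonDyer-23739 --as helper`), CONDITIONAL on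
every displayed hypothesis; credits nothing toward closing any item; BSD is not proved by any of this. No new
definition, no new named fact, no restatement (both route files are imported; decls are used BY NAME).

WHAT. Lead tqs-p1 g4 proved (p588900, `Theorems/TameQuarticSolventSolventPairLowerBoundOfLowerHalves.lean`)
`SolventPairLowerBound ⟸ TprimeRankOneLowerAtThree ∧ KT.TameLowerHalfRankZero ∧ {modularity, FH Thm B(1) at 3}`:
TQS's deciding crux (21391) from TQMP's crux 5 (23739) plus the rank-ZERO LOWER half at `3`. This file is the
converse bookkeeping, i.e. the internal step of TQS's own deciding theorem `closes` isolated BY NAME: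
* `tprimeRankOneLowerAtThree_of_solventPairLowerBound_of_tprimeRankZeroUpper` — 23739 ⟸ 21391 ∧ 21393: for `E` on
  the leaf, 21391 gives the admissible twist `E_d` with `ord₃ q + ord₃ q′ ≤ ord₃ #Ш(E) + ord₃ #Ш(E_d)`, 21393 on
  `E_d` gives `ord₃ #Ш(E_d) ≤ ord₃ q′` (the rational value of `Ш_an(E_d)` is unique), subtraction gives
  `ord₃ q ≤ ord₃ #Ш(E)` = `Typed.MissingLowerBoundAt E 3`;
* (composition, not restated here to stay outside a second route-importing module's cone) with this seat's
  `TprimeRankZeroUpperAtThree.tprimeRankZeroUpperAtThree_of_katoMember_of_upperDefect` (p592306,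
  `Theorems/TameQuarticSolventTprimeRankZeroUpperOfKatoDescent.lean`) the hypothesis 21393 is in turn KT's rank-zero
  UPPER items at `3` {`ReducibleKatoMember` 19196, `TameUpperDefectRankZero` 19982, `PublishedInputsTame` 19198};
* `wAllExclAddTprimeAtThreeRankOne_of_lowerAtThree_of_upperAtThree` — the registered leaf
  `Summit.BirchSwinnertonDyer.WAllExclAddTprimeAtThreeRankOne` ⟸ GZK ∧ 23739 (lower half, r = 1) ∧ TQS crux #3
  21392 (upper half, r = 1): the MINIMAL two-halves form of the (t′) rank-one leaf at `3`, to which both routes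
  reduce (TQS supplies 23739 via 21391 ∧ 21393, TQMP supplies 21392 via its Manin cruxes X₂ ∧ X₃ ∧ X₄).
Together with p588900: `21391 ∧ 21393 ⟹ 23739` and `23739 ∧ 19981 ∧ PUB² ⟹ 21391` — the deciding cruxes of TQS and
TQMP are inter-derivable modulo route KT's rank-zero halves at `3` (upper: 21393 ≡ KT U₀/M/PUB by p592306; lower:
19981, open core 19618) and two print facts; there is ONE wall on the (t′) rank-one leaf: the rank-one LOWER half
of `BSD₃` at an additive potentially supersingular `3` with `e = 4`.

References: R. L. Miller, LMS J. Comput. Math. 14 (2011) Def. 1.1; B. Gross, D. Zagier, Invent. Math. 84 (1986);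
V. A. Kolyvagin (1990); S. Friedberg, J. Hoffstein, Ann. of Math. 142 (1995) Thm. B(1).
-/

-- D-0017: single-problem summit, so `Summit.BirchSwinnertonDyer.BirchSwinnertonDyer.…` repeats a namespace BY DESIGN.
set_option linter.dupNamespace false
set_option autoImplicit false

namespace Summit.BirchSwinnertonDyer.BirchSwinnertonDyer.Theorems.TprimeRankOneLowerAtThree

open Summit.BirchSwinnertonDyer.BirchSwinnertonDyer.Theses Literature.NumberTheory.EllipticCurves.Rank1Residual

/-- **TQMP crux 5 BY NAME from TQS's deciding crux and TQS's rank-zero upper half.** GIVEN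
`TameQuarticSolvent.SolventPairLowerBound` (stmt-BirchSwinnertonDyer-21391: an admissible rank-zero twist `E_d` with the
PAIR inequality `ord₃ Ш_an(E) + ord₃ Ш_an(E_d) ≤ ord₃ #Ш(E) + ord₃ #Ш(E_d)`) and
`TameQuarticSolvent.TprimeRankZeroUpperAtThree` (stmt-BirchSwinnertonDyer-21393: `ord₃ #Ш(E_d) ≤ ord₃ Ш_an(E_d)` on the
non-CM (t′) rank-zero rows), the route decl `TameQuarticManinParity.TprimeRankOneLowerAtThree`
(stmt-BirchSwinnertonDyer-23739: `Typed.MissingLowerBoundAt E 3` on the non-CM (t′) rank-one rows) holds — by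
subtraction (the rational value of `Ш_an(E_d)` is unique, `exact_mod_cast`). This is the first half of TQS's
deciding theorem `TameQuarticSolvent.closes`, isolated. CONDITIONAL; credits nothing. [cite: Miller2011LMS, Def. 1.1] -/
theorem tprimeRankOneLowerAtThree_of_solventPairLowerBound_of_tprimeRankZeroUpper
    (hA : TameQuarticSolvent.SolventPairLowerBound) (hC : TameQuarticSolvent.TprimeRankZeroUpperAtThree) :
    TameQuarticManinParity.TprimeRankOneLowerAtThree := by
  intro W _ _ hCM hadd hsub hr
  obtain ⟨d, Wd, _, _, -, -, -, hCMd, haddd, hsubd, hr0, q, q', hq, hq', hle⟩ := hA W hCM hadd hsub hr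
  obtain ⟨q'', hq'', hge⟩ := hC Wd hCMd haddd hsubd hr0
  have hqq : q'' = q' := by exact_mod_cast hq''.symm.trans hq'
  subst hqq
  exact ⟨q, hq, by linarith⟩

/-- **The (t′) rank-one leaf at `3` in its MINIMAL two-halves form, keyed across the two routes.** GIVEN
Gross–Zagier–Kolyvagin (`TameQuarticSolvent.PublishedInputGZK`, stmt-BirchSwinnertonDyer-19921), TQMP's crux 5
`TprimeRankOneLowerAtThree` (23739: the LOWER half) and TQS's crux #3 `TprimeRankOneUpperAtThree` (21392: the UPPER
half), the registered W-ALL leaf `Summit.BirchSwinnertonDyer.WAllExclAddTprimeAtThreeRankOne` holds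
(`Typed.missingPPartAt_of_lower_of_upper` + `Typed.bsdp_of_missingPPartAt` with `r_an = 1 ≤ 1`). Both routes'
deciding theorems factor through this: TQS supplies 23739 via 21391 ∧ 21393 (above), TQMP supplies 21392 via its
Manin cruxes (`TprimeRankOneUpperAtThree.tprimeRankOneUpperAtThree_of_maninUnit_of_heegnerUpper`). CONDITIONAL;
credits nothing; the leaf is NOT closed by this. [cite: Miller2011LMS, §1 and Def. 1.1] [cite: GrossZagier1986, I.(7.3)]
[cite: Kolyvagin1990] -/
theorem wAllExclAddTprimeAtThreeRankOne_of_lowerAtThree_of_upperAtThree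
    (hP : TameQuarticSolvent.PublishedInputGZK) (h₅ : TameQuarticManinParity.TprimeRankOneLowerAtThree)
    (h₃ : TameQuarticSolvent.TprimeRankOneUpperAtThree) :
    Summit.BirchSwinnertonDyer.WAllExclAddTprimeAtThreeRankOne := by
  intro W _ _ hCM hadd hsub hr
  exact Typed.bsdp_of_missingPPartAt W 3 hP (by omega)
    (Typed.missingPPartAt_of_lower_of_upper W 3 (h₅ W hCM hadd hsub hr) (h₃ W hCM hadd hsub hr))

end Summit.BirchSwinnertonDyer.BirchSwinnertonDyer.Theorems.TprimeRankOneLowerAtThree
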